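import Literature.MathematicalPhysics.KineticTheory.TransportDuhamel
import Literature.MathematicalPhysics.KineticTheory.TruncatedCollisionDerivatives
import Literature.Analysis.FunctionSpaces.IteratedFDerivParametricIntegral
import HarnessLib

/-!
# Slice-derivative estimates for the Duhamel formula of kinetic transport

Topic: MathematicalPhysics / KineticTheory. Continuation of `TransportDuhamel`: bounds on the
derivatives in `z = (x, v)` of the time slices `U(t, ·)` of the Duhamel solution
`U(t,x,v) = f₀(x - tv, v) e^{-∫₀ᵗ Λ♯} + ∫₀ᵗ e^{-∫ₛᵗ Λ♯} Γ(s, x - (t-s)v, v) ds` of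
`∂ₜU + v·∇ₓU = Γ - ΛU`, on a time interval `[0, T]` where `Λ ≥ 0`, weighted by
`(1 + ‖z‖)^k`. The estimate is *affine in the top order*: the derivatives of order `N + 1` of
`Λ(s, ·)` and `Γ(s, ·)` enter only through `∫₀ᵗ λ_{N+1}(s) ds` and `∫₀ᵗ g_{N+1}(s) ds`, with
coefficients depending on `T`, `k`, `N` and the lower-order bounds — the structure that closes,
with the ansatz `M e^{βt}`, the induction on the order in the uniform bounds for the
DiPerna–Lions approximating scheme (CIP 1994, Lemma 5.3.6).

* `exists_shiftCLM`, `norm_iteratedFDeriv_comp_shift_le` — free streaming `S_τ` is linear of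
  norm `≤ 1 + |τ|`, so `‖D^n (h ∘ S_τ)‖ ≤ (1+T)^n ‖D^n h‖ ∘ S_τ`.
* `absorption_slice_iteratedFDeriv_le` — `‖D^i_z ∫ₛᵗ Λ♯‖ ≤ (1+T)^i ∫ₛᵗ λ_i`
  (differentiation under the integral, `norm_iteratedFDeriv_parametric_integral_le`).
* `norm_iteratedFDeriv_expNeg_le`, `expAbsorption_slice_bounds` — derivatives of
  `e^{-∫ₛᵗ Λ♯}`: crude Faà di Bruno below the top order, affine at the top order
  (`norm_iteratedFDeriv_comp_scalar_affine`).
* `duhamel_slice_bound_succ` — the main estimate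
  `(1+‖z‖)^k ‖D^{N+1} U(t)‖ ≤ A + B₁ ∫₀ᵗ λ_{N+1} + B₂ ∫₀ᵗ g_{N+1}` with `A, B₁, B₂` chosen
  before `Λ, Γ, f₀, U`.

Everything is proved; theorems only.

## References

* C. Cercignani, R. Illner, M. Pulvirenti, *The Mathematical Theory of Dilute Gases*, Springer
  (1994), §5.3, Lemma 5.3.6, pp. 145–146.
-/

noncomputable section

open MeasureTheory Set Filter Topology Metric intervalIntegral
open scoped ContDiff

namespace Literature.MathematicalPhysics.KineticTheory

open Literature.Analysis.FunctionSpaces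

variable {E : Type*} [NormedAddCommGroup E] [InnerProductSpace ℝ E] [FiniteDimensional ℝ E]

/-! ## Slice derivatives through the free-streaming map -/

section Shift

omit [InnerProductSpace ℝ E] [FiniteDimensional ℝ E] in
/-- The free-streaming map `S_τ (x, v) = (x - τ v, v)` as a continuous linear map, of norm
`≤ 1 + |τ|`. [folklore] -/
theorem exists_shiftCLM [NormedSpace ℝ E] (τ : ℝ) :
    ∃ S : E × E →L[ℝ] E × E, (∀ z, S z = (z.1 - τ • z.2, z.2)) ∧ ‖S‖ ≤ 1 + |τ| := by
  refine ⟨((ContinuousLinearMap.fst ℝ E E) - τ • (ContinuousLinearMap.snd ℝ E E)).prod (ContinuousLinearMap.snd ℝ E E),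
    fun z => rfl, ?_⟩
  refine ContinuousLinearMap.opNorm_le_bound _ (by positivity) fun z => ?_
  show ‖(z.1 - τ • z.2, z.2)‖ ≤ (1 + |τ|) * ‖z‖
  rw [Prod.norm_def]
  refine max_le ?_ ?_
  · calc ‖z.1 - τ • z.2‖ ≤ ‖z.1‖ + ‖τ • z.2‖ := norm_sub_le _ _
      _ = ‖z.1‖ + |τ| * ‖z.2‖ := by rw [norm_smul, Real.norm_eq_abs]
      _ ≤ ‖z‖ + |τ| * ‖z‖ := add_le_add (norm_fst_le z) (mul_le_mul_of_nonneg_left (norm_snd_le z) (abs_nonneg _))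
      _ = (1 + |τ|) * ‖z‖ := by ring
  · calc ‖z.2‖ ≤ ‖z‖ := norm_snd_le z
      _ ≤ (1 + |τ|) * ‖z‖ := le_mul_of_one_le_left (norm_nonneg _) (by linarith [abs_nonneg τ])

omit [InnerProductSpace ℝ E] [FiniteDimensional ℝ E] in
/-- **Slice derivatives through free streaming**: for `|τ| ≤ T`,
`‖D^n (h ∘ S_τ)(z)‖ ≤ (1+T)^n ‖D^n h (S_τ z)‖`. [folklore] -/
theorem norm_iteratedFDeriv_comp_shift_le [NormedSpace ℝ E] {F' : Type*} [NormedAddCommGroup F'] [NormedSpace ℝ F']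
    {h : E × E → F'} (hh : ContDiff ℝ ∞ h) {τ T : ℝ} (hτ : |τ| ≤ T) (n : ℕ) (z : E × E) :
    ‖iteratedFDeriv ℝ n (fun z : E × E => h (z.1 - τ • z.2, z.2)) z‖ ≤
      (1 + T) ^ n * ‖iteratedFDeriv ℝ n h (z.1 - τ • z.2, z.2)‖ := by
  obtain ⟨S, hS, hSn⟩ := exists_shiftCLM (E := E) τ
  have hcomp : (fun z : E × E => h (z.1 - τ • z.2, z.2)) = h ∘ S := by funext z; rw [Function.comp_apply, hS]
  rw [hcomp, S.iteratedFDeriv_comp_right hh z (by exact_mod_cast le_top), ← hS z]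
  refine (ContinuousMultilinearMap.norm_compContinuousLinearMap_le _ _).trans ?_
  rw [Finset.prod_const, Finset.card_univ, Fintype.card_fin, mul_comm]
  refine mul_le_mul_of_nonneg_right (pow_le_pow_left₀ (norm_nonneg _) (hSn.trans (by linarith)) _) (norm_nonneg _)

end Shift

/-! ## The absorption integral and its exponential -/

section Absorption

variable {Λ : ℝ × E × E → ℝ}

/-- **Slice derivatives of the absorption integral** `J(s,t,z) = ∫ₛᵗ Λ(σ, x - (t-σ)v, v) dσ`
(`0 ≤ s ≤ t ≤ T`): `‖D^i_z J(s,t,·)(z)‖ ≤ (1+T)^i ∫ₛᵗ λ_i(σ) dσ` when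
`‖D^i Λ(σ,·)‖ ≤ λ_i(σ)`. [folklore] -/
theorem absorption_slice_iteratedFDeriv_le (hΛ : ContDiff ℝ ∞ Λ) {T : ℝ} (i : ℕ)
    {lam : ℝ → ℝ} (hlamc : Continuous lam)
    (hlam : ∀ σ ∈ Icc 0 T, ∀ z : E × E, ‖iteratedFDeriv ℝ i (fun z : E × E => Λ (σ, z.1, z.2)) z‖ ≤ lam σ)
    {s t : ℝ} (hs : 0 ≤ s) (hst : s ≤ t) (ht : t ≤ T) (z : E × E) :
    ‖iteratedFDeriv ℝ i (fun z : E × E => ∫ σ in s..t, Λ (σ, z.1 - (t - σ) • z.2, z.2)) z‖ ≤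
      (1 + T) ^ i * ∫ σ in s..t, lam σ := by
  have hT : 0 ≤ T := hs.trans (hst.trans ht)
  -- as a parametric integral over `Ioc s t`
  set G : ℝ × (E × E) → ℝ := fun q => Λ (q.1, q.2.1 - (t - q.1) • q.2.2, q.2.2) with hG
  have hGs : ContDiff ℝ ∞ G := hΛ.comp (contDiff_fst.prodMk (((contDiff_fst.comp contDiff_snd).sub
    ((contDiff_const.sub contDiff_fst).smul (contDiff_snd.comp contDiff_snd))).prodMk (contDiff_snd.comp contDiff_snd)))
  set μ : Measure ℝ := (volume : Measure ℝ).restrict (Ioc s t) with hμ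
  haveI : IsFiniteMeasure μ := ⟨by rw [hμ, Measure.restrict_apply_univ]; exact measure_Ioc_lt_top⟩
  have heq : (fun z : E × E => ∫ σ in s..t, Λ (σ, z.1 - (t - σ) • z.2, z.2)) = fun z => ∫ σ, G (id σ, z) ∂μ := by
    funext z; rw [intervalIntegral.integral_of_le hst]; rfl
  have hK : ∀ᵐ σ ∂μ, id σ ∈ Icc s t := by
    rw [hμ]; exact (ae_restrict_mem measurableSet_Ioc).mono fun σ hσ => Ioc_subset_Icc_self hσ
  rw [heq]
  refine (norm_iteratedFDeriv_parametric_integral_le (μ := μ) measurable_id isCompact_Icc hK hGs i z).trans ?_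
  -- pointwise bound of the sections
  have hpt : ∀ σ ∈ Ioc s t, ‖iteratedFDeriv ℝ i (fun r : E × E => G (id σ, r)) z‖ ≤ (1 + T) ^ i * lam σ := by
    intro σ hσ
    have hτ : |t - σ| ≤ T := by
      rw [abs_of_nonneg (by linarith [hσ.2])]; linarith [hσ.1]
    have h1 := norm_iteratedFDeriv_comp_shift_le (h := fun z : E × E => Λ (σ, z.1, z.2))
      (hΛ.comp (contDiff_const.prodMk contDiff_id)) hτ i z
    refine h1.trans (mul_le_mul_of_nonneg_left (hlam σ ⟨hs.trans hσ.1.le, hσ.2.trans ht⟩ _) (by positivity))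
  calc ∫ σ, ‖iteratedFDeriv ℝ i (fun r : E × E => G (id σ, r)) z‖ ∂μ
      ≤ ∫ σ, (1 + T) ^ i * lam σ ∂μ := by
        rw [hμ]
        refine setIntegral_mono_on ?_ ((continuous_const.mul hlamc).integrableOn_Icc.mono_set Ioc_subset_Icc_self)
          measurableSet_Ioc hpt
        exact (integrable_iteratedFDeriv_section (μ := μ) measurable_id isCompact_Icc hK hGs i z).norm
    _ = (1 + T) ^ i * ∫ σ in s..t, lam σ := by
        rw [MeasureTheory.integral_const_mul, hμ, ← intervalIntegral.integral_of_le hst]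

end Absorption

/-! ## The exponential of the absorption integral -/

section ExpAbsorption

variable {Λ : ℝ × E × E → ℝ}

omit [InnerProductSpace ℝ E] [FiniteDimensional ℝ E] in
/-- Derivatives of `y ↦ e^{-y}` have absolute value `e^{-y} ≤ 1` on `[0, ∞)`. [folklore] -/
theorem norm_iteratedFDeriv_expNeg_le (j : ℕ) {y : ℝ} (hy : 0 ≤ y) :
    ‖iteratedFDeriv ℝ j (fun s : ℝ => Real.exp ((-1 : ℝ) * s)) y‖ ≤ 1 := by
  rw [norm_iteratedFDeriv_eq_norm_iteratedDeriv, iteratedDeriv_exp_const_mul]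
  rw [Real.norm_eq_abs, abs_mul, abs_pow, abs_neg, abs_one, one_pow, one_mul, Real.abs_exp,
    Real.exp_le_one_iff]
  linarith

/-- **Slice derivatives of `e^{-J}`**, `J(s,t,·)` the absorption integral (`0 ≤ s ≤ t ≤ T`,
`Λ ≥ 0` on `[0,T]`, `‖D^i Λ(σ,·)‖ ≤ λ_i` for `i ≤ N` and `‖D^{N+1} Λ(σ,·)‖ ≤ λ_{N+1}(σ)`).
With `D = 1 + Σ_{i≤N} (1+T)^i T λ_i`: the crude bounds `‖D^j e^{-J}‖ ≤ j! D^j` (`j ≤ N`) and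
the top-order bound, affine in `∫₀ᵗ λ_{N+1}`:
`‖D^{N+1} e^{-J}‖ ≤ (1+T)^{N+1} ∫₀ᵗ λ_{N+1} + Σ_{i=1}^{N} C(N,i) i! D^i (1+T)^{N+1-i} T λ_{N+1-i}`.
[folklore] -/
theorem expAbsorption_slice_bounds (hΛ : ContDiff ℝ ∞ Λ) {T : ℝ} (N : ℕ)
    (hΛ0 : ∀ σ ∈ Icc (0 : ℝ) T, ∀ x v : E, 0 ≤ Λ (σ, x, v))
    {lamC : ℕ → ℝ} (hlamC0 : ∀ i, 0 ≤ lamC i)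
    (hlam : ∀ i, i ≤ N → ∀ σ ∈ Icc (0 : ℝ) T, ∀ z : E × E,
      ‖iteratedFDeriv ℝ i (fun z : E × E => Λ (σ, z.1, z.2)) z‖ ≤ lamC i)
    {lamTop : ℝ → ℝ} (hlamTopc : Continuous lamTop) (hlamTop0 : ∀ σ, 0 ≤ lamTop σ)
    (hlamTop : ∀ σ ∈ Icc (0 : ℝ) T, ∀ z : E × E,
      ‖iteratedFDeriv ℝ (N + 1) (fun z : E × E => Λ (σ, z.1, z.2)) z‖ ≤ lamTop σ)
    {s t : ℝ} (hs : 0 ≤ s) (hst : s ≤ t) (ht : t ≤ T) (z : E × E) :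
    (∀ j, j ≤ N → ‖iteratedFDeriv ℝ j (fun z : E × E =>
        Real.exp ((-1 : ℝ) * ∫ σ in s..t, Λ (σ, z.1 - (t - σ) • z.2, z.2))) z‖ ≤
        (Nat.factorial j : ℝ) * (1 + ∑ i ∈ Finset.range (N + 1), (1 + T) ^ i * T * lamC i) ^ j) ∧
    ‖iteratedFDeriv ℝ (N + 1) (fun z : E × E =>
        Real.exp ((-1 : ℝ) * ∫ σ in s..t, Λ (σ, z.1 - (t - σ) • z.2, z.2))) z‖ ≤
      (1 + T) ^ (N + 1) * (∫ σ in (0 : ℝ)..t, lamTop σ) +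
        ∑ i ∈ Finset.Icc 1 N, (N.choose i : ℝ) *
          ((Nat.factorial i : ℝ) * (1 + ∑ i ∈ Finset.range (N + 1), (1 + T) ^ i * T * lamC i) ^ i) *
          ((1 + T) ^ (N + 1 - i) * T * lamC (N + 1 - i)) := by
  have hT : 0 ≤ T := hs.trans (hst.trans ht)
  set D : ℝ := 1 + ∑ i ∈ Finset.range (N + 1), (1 + T) ^ i * T * lamC i with hD
  have hD1 : 1 ≤ D := by
    rw [hD]; linarith [Finset.sum_nonneg fun i (_ : i ∈ Finset.range (N + 1)) =>
      (by have := hlamC0 i; positivity : (0 : ℝ) ≤ (1 + T) ^ i * T * lamC i)]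
  -- the inner function and its range
  set u : E × E → ℝ := fun z => ∫ σ in s..t, Λ (σ, z.1 - (t - σ) • z.2, z.2) with hu
  have hus : ContDiff ℝ ∞ u := (contDiff_absorptionIntegral₂ hΛ).comp
    (contDiff_const.prodMk (contDiff_const.prodMk contDiff_id) :
      ContDiff ℝ ∞ fun z : E × E => (s, t, z.1, z.2))
  set φ : ℝ → ℝ := fun y => Real.exp ((-1 : ℝ) * y) with hφ
  have hφs : ContDiff ℝ ∞ φ := Real.contDiff_exp.comp (contDiff_const.mul contDiff_id)
  have hcomp : (fun z : E × E => Real.exp ((-1 : ℝ) * ∫ σ in s..t, Λ (σ, z.1 - (t - σ) • z.2, z.2))) = φ ∘ u := by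
    funext z; rfl
  have hu0 : ∀ z, 0 ≤ u z := fun z =>
    intervalIntegral.integral_nonneg hst fun σ hσ => hΛ0 σ ⟨hs.trans hσ.1, hσ.2.trans ht⟩ _ _
  -- derivative bounds for `u`
  have hDu : ∀ i, i ≤ N → ∀ z, ‖iteratedFDeriv ℝ i u z‖ ≤ (1 + T) ^ i * T * lamC i := by
    intro i hi z
    have h := absorption_slice_iteratedFDeriv_le hΛ i continuous_const (fun σ hσ z => hlam i hi σ hσ z) hs hst ht z
    refine h.trans ?_
    rw [intervalIntegral.integral_const, smul_eq_mul, mul_assoc]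
    exact mul_le_mul_of_nonneg_left (mul_le_mul_of_nonneg_right (by linarith) (hlamC0 i)) (by positivity)
  have hDuD : ∀ i, 1 ≤ i → i ≤ N → ∀ z, ‖iteratedFDeriv ℝ i u z‖ ≤ D ^ i := by
    intro i hi1 hi z
    refine (hDu i hi z).trans ?_
    have hle : (1 + T) ^ i * T * lamC i ≤ D := by
      rw [hD]
      have hmem : i ∈ Finset.range (N + 1) := Finset.mem_range.2 (Nat.lt_succ_of_le hi)
      have hsingle := Finset.single_le_sum (fun j (_ : j ∈ Finset.range (N + 1)) =>
        (by have := hlamC0 j; positivity : (0 : ℝ) ≤ (1 + T) ^ j * T * lamC j)) hmem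
      linarith
    calc (1 + T) ^ i * T * lamC i ≤ D := hle
      _ = D ^ 1 := (pow_one D).symm
      _ ≤ D ^ i := pow_le_pow_right₀ hD1 hi1
  have hDuN : ∀ z, ‖iteratedFDeriv ℝ (N + 1) u z‖ ≤ (1 + T) ^ (N + 1) * ∫ σ in (0 : ℝ)..t, lamTop σ := by
    intro z
    have h := absorption_slice_iteratedFDeriv_le hΛ (N + 1) hlamTopc hlamTop hs hst ht z
    refine h.trans (mul_le_mul_of_nonneg_left ?_ (by positivity))
    rw [intervalIntegral.integral_of_le hst, intervalIntegral.integral_of_le (hs.trans hst)]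
    exact setIntegral_mono_set (hlamTopc.integrableOn_Icc.mono_set Ioc_subset_Icc_self)
      (Eventually.of_forall hlamTop0) (Ioc_subset_Ioc_left hs).eventuallyLE
  -- bounds on the derivatives of `φ` along the range of `u`
  have hφb : ∀ (j : ℕ) (z : E × E), ‖iteratedFDeriv ℝ j φ (u z)‖ ≤ 1 := fun j z =>
    norm_iteratedFDeriv_expNeg_le j (hu0 z)
  rw [hcomp]
  refine ⟨fun j hj => ?_, ?_⟩
  · -- crude Faà di Bruno
    have h := norm_iteratedFDeriv_comp_le (g := φ) (f := u) (n := j) (N := ∞) hφs hus (by exact_mod_cast le_top) z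
      (C := 1) (D := D) (fun i _ => hφb i z) (fun i hi1 hij => hDuD i hi1 (hij.trans hj) z)
    simpa using h
  · -- affine Faà di Bruno at the top order
    have hrange : ∀ z, u z ∈ Icc (0 : ℝ) ((1 + T) ^ 0 * T * lamC 0) := fun z =>
      ⟨hu0 z, by
        have h := hDu 0 (Nat.zero_le _) z
        rw [norm_iteratedFDeriv_zero, Real.norm_eq_abs] at h
        exact (le_abs_self _).trans h⟩
    have h := norm_iteratedFDeriv_comp_scalar_affine hφs hus hrange N z (Φ₁ := 1) (Φm := 1) (D := D)
      (fun y hy => norm_iteratedFDeriv_expNeg_le 1 hy.1)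
      (fun j _ _ y hy => norm_iteratedFDeriv_expNeg_le j hy.1)
      (fun i hi1 hiN => hDuD i hi1 hiN z)
    refine h.trans ?_
    rw [one_mul]
    refine add_le_add (hDuN z) (Finset.sum_le_sum fun i hi => ?_)
    rw [Finset.mem_Icc] at hi
    rw [mul_one]
    refine mul_le_mul_of_nonneg_left ?_ (by positivity)
    exact hDu (N + 1 - i) (by omega) z

end ExpAbsorption

/-! ## Slice derivatives of the Duhamel formula -/

section DuhamelSlice

/-- **Weighted slice-derivative bounds for the Duhamel formula, affine in the top order.**
Fix `T ≥ 0`, a weight `k`, an order `N + 1`, and numerical bounds `λ_i` (derivatives of the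
absorption coefficient of orders `≤ N`), `g_i` (weighted derivatives of the source of orders
`≤ N`) and `F_i` (weighted derivatives of the datum of orders `≤ N + 1`). Then there are
constants `A, B₁, B₂ ≥ 0` depending only on these data such that for *any* smooth
`Λ ≥ 0`, `Γ`, `f₀` obeying them, with top-order bounds `‖D^{N+1} Λ(s)‖ ≤ λ_{N+1}(s)` and
`(1+‖z‖)^k ‖D^{N+1} Γ(s)‖ ≤ g_{N+1}(s)`, the Duhamel solution satisfies on `[0, T]`
`(1+‖z‖)^k ‖D^{N+1} U(t)‖ ≤ A + B₁ ∫₀ᵗ λ_{N+1} + B₂ ∫₀ᵗ g_{N+1}`.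
(Leibniz; `D^n` commutes with free streaming up to `(1+T)^n`; `e^{-∫Λ}` through
`expAbsorption_slice_bounds`; differentiation under `∫₀ᵗ ds`.) This is the estimate that is
iterated, with the ansatz `M e^{βt}` for the top order, in the construction of the
DiPerna–Lions approximate solutions (cf. CIP 1994 §5.3, Lemma 5.3.6). [folklore] -/
theorem duhamel_slice_bound_succ {T : ℝ} (hT : 0 ≤ T) (k N : ℕ) {lamC gC F : ℕ → ℝ}
    (hlamC0 : ∀ i, 0 ≤ lamC i) (hgC0 : ∀ i, 0 ≤ gC i) (hF0 : ∀ i, 0 ≤ F i) :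
    ∃ A B₁ B₂ : ℝ, 0 ≤ A ∧ 0 ≤ B₁ ∧ 0 ≤ B₂ ∧
      ∀ ⦃Λ Γ : ℝ × E × E → ℝ⦄ ⦃f₀ : E × E → ℝ⦄ ⦃U : ℝ × E × E → ℝ⦄,
        ContDiff ℝ ∞ f₀ → ContDiff ℝ ∞ Λ → ContDiff ℝ ∞ Γ →
        (∀ t x v, U (t, x, v) =
          f₀ (x - t • v, v) * Real.exp (-(∫ σ in (0 : ℝ)..t, Λ (σ, x - (t - σ) • v, v))) +
            ∫ s in (0 : ℝ)..t, Real.exp (-(∫ σ in s..t, Λ (σ, x - (t - σ) • v, v))) *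
              Γ (s, x - (t - s) • v, v)) →
        (∀ s ∈ Icc (0 : ℝ) T, ∀ x v, 0 ≤ Λ (s, x, v)) →
        (∀ i, i ≤ N → ∀ s ∈ Icc (0 : ℝ) T, ∀ z : E × E,
          ‖iteratedFDeriv ℝ i (fun z : E × E => Λ (s, z.1, z.2)) z‖ ≤ lamC i) →
        ∀ ⦃lamTop : ℝ → ℝ⦄, Continuous lamTop → (∀ σ, 0 ≤ lamTop σ) →
          (∀ s ∈ Icc (0 : ℝ) T, ∀ z : E × E,
            ‖iteratedFDeriv ℝ (N + 1) (fun z : E × E => Λ (s, z.1, z.2)) z‖ ≤ lamTop s) →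
        (∀ i, i ≤ N → ∀ s ∈ Icc (0 : ℝ) T, ∀ z : E × E,
          (1 + ‖z‖) ^ k * ‖iteratedFDeriv ℝ i (fun z : E × E => Γ (s, z.1, z.2)) z‖ ≤ gC i) →
        ∀ ⦃gTop : ℝ → ℝ⦄, Continuous gTop → (∀ σ, 0 ≤ gTop σ) →
          (∀ s ∈ Icc (0 : ℝ) T, ∀ z : E × E,
            (1 + ‖z‖) ^ k * ‖iteratedFDeriv ℝ (N + 1) (fun z : E × E => Γ (s, z.1, z.2)) z‖ ≤ gTop s) →
        (∀ i, i ≤ N + 1 → ∀ z : E × E, (1 + ‖z‖) ^ k * ‖iteratedFDeriv ℝ i f₀ z‖ ≤ F i) →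
        ∀ t ∈ Icc (0 : ℝ) T, ∀ z : E × E,
          (1 + ‖z‖) ^ k * ‖iteratedFDeriv ℝ (N + 1) (fun z : E × E => U (t, z.1, z.2)) z‖ ≤
            A + B₁ * (∫ s in (0 : ℝ)..t, lamTop s) + B₂ * ∫ s in (0 : ℝ)..t, gTop s := by
  -- the constants
  set D : ℝ := 1 + ∑ i ∈ Finset.range (N + 1), (1 + T) ^ i * T * lamC i with hD
  set ε' : ℝ := ∑ i ∈ Finset.Icc 1 N, (N.choose i : ℝ) * ((Nat.factorial i : ℝ) * D ^ i) *
    ((1 + T) ^ (N + 1 - i) * T * lamC (N + 1 - i)) with hε'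
  set cr : ℕ → ℝ := fun j => (Nat.factorial j : ℝ) * D ^ j with hcr
  set A₁ : ℝ := (1 + T) ^ k * F 0 * ε' + ∑ i ∈ Finset.range (N + 1),
    ((N + 1).choose (i + 1) : ℝ) * ((1 + T) ^ (k + (i + 1)) * F (i + 1)) * cr (N - i) with hA₁
  set A₂ : ℝ := (1 + T) ^ k * gC 0 * ε' + ∑ i ∈ Finset.range N,
    ((N + 1).choose (i + 1) : ℝ) * cr (i + 1) * ((1 + T) ^ (k + (N - i)) * gC (N - i)) with hA₂
  have hD1 : 1 ≤ D := by
    rw [hD]; linarith [Finset.sum_nonneg fun i (_ : i ∈ Finset.range (N + 1)) =>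
      (by have := hlamC0 i; positivity : (0 : ℝ) ≤ (1 + T) ^ i * T * lamC i)]
  have hD0 : 0 ≤ D := by linarith
  have hε'0 : 0 ≤ ε' := Finset.sum_nonneg fun i _ => by have := hlamC0 (N + 1 - i); positivity
  have hcr0 : ∀ j, 0 ≤ cr j := fun j => by simp only [hcr]; positivity
  have hA₁0 : 0 ≤ A₁ := by
    have := hF0 0
    have hs := Finset.sum_nonneg fun i (_ : i ∈ Finset.range (N + 1)) =>
      (by have := hF0 (i + 1); have := hcr0 (N - i); positivity :
        (0 : ℝ) ≤ ((N + 1).choose (i + 1) : ℝ) * ((1 + T) ^ (k + (i + 1)) * F (i + 1)) * cr (N - i))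
    positivity
  have hA₂0 : 0 ≤ A₂ := by
    have := hgC0 0
    have hs := Finset.sum_nonneg fun i (_ : i ∈ Finset.range N) =>
      (by have := hgC0 (N - i); have := hcr0 (i + 1); positivity :
        (0 : ℝ) ≤ ((N + 1).choose (i + 1) : ℝ) * cr (i + 1) * ((1 + T) ^ (k + (N - i)) * gC (N - i)))
    positivity
  refine ⟨A₁ + T * A₂, (1 + T) ^ (k + (N + 1)) * (F 0 + T * gC 0), (1 + T) ^ (k + (N + 1)),
    by positivity, by have := hF0 0; have := hgC0 0; positivity, by positivity, ?_⟩
  intro Λ Γ f₀ U hf₀ hΛ hΓ hU hΛ0 hlam lamTop hlamTopc hlamTop0 hlamTop hg gTop hgTopc hgTop0 hgTop hF t ht z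
  obtain ⟨ht0, htT⟩ := ht
  set w : ℝ := (1 + ‖z‖) ^ k with hw
  have hw0 : 0 < w := by positivity
  set L : ℝ := ∫ s in (0 : ℝ)..t, lamTop s with hL
  have hL0 : 0 ≤ L := intervalIntegral.integral_nonneg ht0 fun s _ => hlamTop0 s
  set Gi : ℝ := ∫ s in (0 : ℝ)..t, gTop s with hGi
  have hGi0 : 0 ≤ Gi := intervalIntegral.integral_nonneg ht0 fun s _ => hgTop0 s
  have hτt : |t| ≤ T := by rw [abs_of_nonneg ht0]; exact htT
  -- the exponential factors and their slice-derivative bounds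
  set Ef : ℝ → E × E → ℝ := fun s z => Real.exp ((-1 : ℝ) * ∫ σ in s..t, Λ (σ, z.1 - (t - σ) • z.2, z.2)) with hEf
  have hEfs : ∀ s, ContDiff ℝ ∞ (Ef s) := fun s =>
    (Real.contDiff_exp.comp (contDiff_const.mul contDiff_id)).comp ((contDiff_absorptionIntegral₂ hΛ).comp
      (contDiff_const.prodMk (contDiff_const.prodMk contDiff_id) : ContDiff ℝ ∞ fun z : E × E => (s, t, z.1, z.2)))
  have hEcr : ∀ s, 0 ≤ s → s ≤ t → ∀ j, j ≤ N → ∀ z : E × E, ‖iteratedFDeriv ℝ j (Ef s) z‖ ≤ cr j :=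
    fun s hs hst j hj z => (expAbsorption_slice_bounds hΛ N hΛ0 hlamC0 hlam hlamTopc hlamTop0 hlamTop hs hst htT z).1 j hj
  have hEtop : ∀ s, 0 ≤ s → s ≤ t → ∀ z : E × E, ‖iteratedFDeriv ℝ (N + 1) (Ef s) z‖ ≤ (1 + T) ^ (N + 1) * L + ε' :=
    fun s hs hst z => (expAbsorption_slice_bounds hΛ N hΛ0 hlamC0 hlam hlamTopc hlamTop0 hlamTop hs hst htT z).2
  -- (1) the first term `f₀ ∘ S_t · Ef 0`
  set T1f : E × E → ℝ := fun z => f₀ (z.1 - t • z.2, z.2) * Ef 0 z with hT1f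
  have hS : ContDiff ℝ ∞ fun z : E × E => f₀ (z.1 - t • z.2, z.2) :=
    hf₀.comp ((contDiff_fst.sub (contDiff_const.smul contDiff_snd)).prodMk contDiff_snd)
  have hT1s : ContDiff ℝ ∞ T1f := hS.mul (hEfs 0)
  have hf₀S : ∀ i, i ≤ N + 1 → w * ‖iteratedFDeriv ℝ i (fun z : E × E => f₀ (z.1 - t • z.2, z.2)) z‖ ≤
      (1 + T) ^ (k + i) * F i := by
    intro i hi
    have h1 := norm_iteratedFDeriv_comp_shift_le (h := f₀) hf₀ hτt i z
    have hws := weight_le_shift z.1 z.2 hτt k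
    have hFi := hF i hi (z.1 - t • z.2, z.2)
    calc w * ‖iteratedFDeriv ℝ i (fun z : E × E => f₀ (z.1 - t • z.2, z.2)) z‖
        ≤ ((1 + T) ^ k * (1 + ‖(z.1 - t • z.2, z.2)‖) ^ k) * ((1 + T) ^ i * ‖iteratedFDeriv ℝ i f₀ (z.1 - t • z.2, z.2)‖) :=
          mul_le_mul hws h1 (norm_nonneg _) (by positivity)
      _ = (1 + T) ^ (k + i) * ((1 + ‖(z.1 - t • z.2, z.2)‖) ^ k * ‖iteratedFDeriv ℝ i f₀ (z.1 - t • z.2, z.2)‖) := by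
          rw [pow_add]; ring
      _ ≤ (1 + T) ^ (k + i) * F i := mul_le_mul_of_nonneg_left hFi (by positivity)
  have hbound1 : w * ‖iteratedFDeriv ℝ (N + 1) T1f z‖ ≤ A₁ + (1 + T) ^ (k + (N + 1)) * F 0 * L := by
    have hleib := norm_iteratedFDeriv_mul_le (n := N + 1) hS (hEfs 0) z (by exact_mod_cast le_top)
    refine (mul_le_mul_of_nonneg_left hleib hw0.le).trans ?_
    rw [Finset.mul_sum, Finset.sum_range_succ']
    -- the term `i = 0` carries the top-order derivative of `Ef 0`
    have hterm0 : w * (((N + 1).choose 0 : ℝ) * ‖iteratedFDeriv ℝ 0 (fun z : E × E => f₀ (z.1 - t • z.2, z.2)) z‖ *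
        ‖iteratedFDeriv ℝ (N + 1 - 0) (Ef 0) z‖) ≤ (1 + T) ^ k * F 0 * ε' + (1 + T) ^ (k + (N + 1)) * F 0 * L := by
      have h0 := hf₀S 0 (Nat.zero_le _)
      rw [add_zero] at h0
      simp only [Nat.choose_zero_right, Nat.cast_one, one_mul, Nat.sub_zero]
      calc w * (‖iteratedFDeriv ℝ 0 (fun z : E × E => f₀ (z.1 - t • z.2, z.2)) z‖ * ‖iteratedFDeriv ℝ (N + 1) (Ef 0) z‖)
          = (w * ‖iteratedFDeriv ℝ 0 (fun z : E × E => f₀ (z.1 - t • z.2, z.2)) z‖) * ‖iteratedFDeriv ℝ (N + 1) (Ef 0) z‖ := by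
            ring
        _ ≤ ((1 + T) ^ k * F 0) * ((1 + T) ^ (N + 1) * L + ε') :=
            mul_le_mul h0 (hEtop 0 le_rfl ht0 z) (norm_nonneg _) (by have := hF0 0; positivity)
        _ = (1 + T) ^ k * F 0 * ε' + (1 + T) ^ (k + (N + 1)) * F 0 * L := by rw [pow_add]; ring
    -- the terms `i + 1` only see crude bounds
    have hterms : ∀ i ∈ Finset.range (N + 1),
        w * (((N + 1).choose (i + 1) : ℝ) * ‖iteratedFDeriv ℝ (i + 1) (fun z : E × E => f₀ (z.1 - t • z.2, z.2)) z‖ *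
          ‖iteratedFDeriv ℝ (N + 1 - (i + 1)) (Ef 0) z‖) ≤
          ((N + 1).choose (i + 1) : ℝ) * ((1 + T) ^ (k + (i + 1)) * F (i + 1)) * cr (N - i) := by
      intro i hi
      rw [Finset.mem_range] at hi
      have h1 := hf₀S (i + 1) (by omega)
      have h2 := hEcr 0 le_rfl ht0 (N - i) (Nat.sub_le _ _) z
      rw [show N + 1 - (i + 1) = N - i by omega]
      calc w * (((N + 1).choose (i + 1) : ℝ) * ‖iteratedFDeriv ℝ (i + 1) (fun z : E × E => f₀ (z.1 - t • z.2, z.2)) z‖ *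
            ‖iteratedFDeriv ℝ (N - i) (Ef 0) z‖)
          = ((N + 1).choose (i + 1) : ℝ) * (w * ‖iteratedFDeriv ℝ (i + 1) (fun z : E × E => f₀ (z.1 - t • z.2, z.2)) z‖) *
              ‖iteratedFDeriv ℝ (N - i) (Ef 0) z‖ := by ring
        _ ≤ ((N + 1).choose (i + 1) : ℝ) * ((1 + T) ^ (k + (i + 1)) * F (i + 1)) * cr (N - i) :=
            mul_le_mul (mul_le_mul_of_nonneg_left h1 (by positivity)) h2 (norm_nonneg _)
              (by have := hF0 (i + 1); positivity)
    have hsum := Finset.sum_le_sum hterms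
    rw [hA₁]
    linarith [hsum, hterm0]
  -- (2) the Duhamel integral term
  set Kf : ℝ × (E × E) → ℝ := fun q => Ef q.1 q.2 * Γ (q.1, q.2.1 - (t - q.1) • q.2.2, q.2.2) with hKf
  have hKs : ContDiff ℝ ∞ Kf := by
    have hE2 : ContDiff ℝ ∞ fun q : ℝ × (E × E) => Ef q.1 q.2 :=
      (Real.contDiff_exp.comp (contDiff_const.mul contDiff_id)).comp ((contDiff_absorptionIntegral₂ hΛ).comp
        (contDiff_fst.prodMk (contDiff_const.prodMk contDiff_snd) :
          ContDiff ℝ ∞ fun q : ℝ × (E × E) => (q.1, t, q.2.1, q.2.2)))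
    refine hE2.mul (hΓ.comp ?_)
    exact contDiff_fst.prodMk (((contDiff_fst.comp contDiff_snd).sub
      ((contDiff_const.sub contDiff_fst).smul (contDiff_snd.comp contDiff_snd))).prodMk (contDiff_snd.comp contDiff_snd))
  set T2f : E × E → ℝ := fun z => ∫ s in (0 : ℝ)..t, Kf (s, z) with hT2f
  set μ : Measure ℝ := (volume : Measure ℝ).restrict (Ioc 0 t) with hμ
  haveI : IsFiniteMeasure μ := ⟨by rw [hμ, Measure.restrict_apply_univ]; exact measure_Ioc_lt_top⟩
  have hKmem : ∀ᵐ s ∂μ, id s ∈ Icc (0 : ℝ) t := by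
    rw [hμ]; exact (ae_restrict_mem measurableSet_Ioc).mono fun s hs => Ioc_subset_Icc_self hs
  have hT2eq : T2f = fun z => ∫ s, Kf (id s, z) ∂μ := by
    funext z; simp only [hT2f]; rw [intervalIntegral.integral_of_le ht0]; rfl
  have hT2s : ContDiff ℝ ∞ T2f := by
    rw [hT2eq]
    exact contDiff_parametric_integral (μ := μ) measurable_id isCompact_Icc hKmem hKs
  -- pointwise bound for the sections `D^{N+1} Kf(s, ·)`
  have hKsec : ∀ s ∈ Ioc (0 : ℝ) t, w * ‖iteratedFDeriv ℝ (N + 1) (fun r : E × E => Kf (id s, r)) z‖ ≤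
      A₂ + (1 + T) ^ (k + (N + 1)) * (gC 0 * L + gTop s) := by
    intro s hs
    have hs0 : 0 ≤ s := hs.1.le
    have hst : s ≤ t := hs.2
    have hsT : s ∈ Icc (0 : ℝ) T := ⟨hs0, hst.trans htT⟩
    have hτ : |t - s| ≤ T := by rw [abs_of_nonneg (by linarith)]; linarith
    -- the shifted source and its weighted derivative bounds
    have hΓS : ContDiff ℝ ∞ fun r : E × E => Γ (s, r.1 - (t - s) • r.2, r.2) :=
      (hΓ.comp (contDiff_const.prodMk contDiff_id : ContDiff ℝ ∞ fun z : E × E => (s, z.1, z.2))).comp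
        ((contDiff_fst.sub (contDiff_const.smul contDiff_snd)).prodMk contDiff_snd)
    have hΓi : ∀ i, i ≤ N → w * ‖iteratedFDeriv ℝ i (fun r : E × E => Γ (s, r.1 - (t - s) • r.2, r.2)) z‖ ≤
        (1 + T) ^ (k + i) * gC i := by
      intro i hi
      have h1 := norm_iteratedFDeriv_comp_shift_le (h := fun z : E × E => Γ (s, z.1, z.2))
        (hΓ.comp (contDiff_const.prodMk contDiff_id)) hτ i z
      have hws := weight_le_shift z.1 z.2 hτ k
      have hgi := hg i hi s hsT (z.1 - (t - s) • z.2, z.2)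
      calc w * ‖iteratedFDeriv ℝ i (fun r : E × E => Γ (s, r.1 - (t - s) • r.2, r.2)) z‖
          ≤ ((1 + T) ^ k * (1 + ‖(z.1 - (t - s) • z.2, z.2)‖) ^ k) *
              ((1 + T) ^ i * ‖iteratedFDeriv ℝ i (fun z : E × E => Γ (s, z.1, z.2)) (z.1 - (t - s) • z.2, z.2)‖) :=
            mul_le_mul hws h1 (norm_nonneg _) (by positivity)
        _ = (1 + T) ^ (k + i) * ((1 + ‖(z.1 - (t - s) • z.2, z.2)‖) ^ k *
              ‖iteratedFDeriv ℝ i (fun z : E × E => Γ (s, z.1, z.2)) (z.1 - (t - s) • z.2, z.2)‖) := by rw [pow_add]; ring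
        _ ≤ (1 + T) ^ (k + i) * gC i := mul_le_mul_of_nonneg_left hgi (by positivity)
    have hΓtop : w * ‖iteratedFDeriv ℝ (N + 1) (fun r : E × E => Γ (s, r.1 - (t - s) • r.2, r.2)) z‖ ≤
        (1 + T) ^ (k + (N + 1)) * gTop s := by
      have h1 := norm_iteratedFDeriv_comp_shift_le (h := fun z : E × E => Γ (s, z.1, z.2))
        (hΓ.comp (contDiff_const.prodMk contDiff_id)) hτ (N + 1) z
      have hws := weight_le_shift z.1 z.2 hτ k
      have hgi := hgTop s hsT (z.1 - (t - s) • z.2, z.2)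
      calc w * ‖iteratedFDeriv ℝ (N + 1) (fun r : E × E => Γ (s, r.1 - (t - s) • r.2, r.2)) z‖
          ≤ ((1 + T) ^ k * (1 + ‖(z.1 - (t - s) • z.2, z.2)‖) ^ k) *
              ((1 + T) ^ (N + 1) * ‖iteratedFDeriv ℝ (N + 1) (fun z : E × E => Γ (s, z.1, z.2)) (z.1 - (t - s) • z.2, z.2)‖) :=
            mul_le_mul hws h1 (norm_nonneg _) (by positivity)
        _ = (1 + T) ^ (k + (N + 1)) * ((1 + ‖(z.1 - (t - s) • z.2, z.2)‖) ^ k *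
              ‖iteratedFDeriv ℝ (N + 1) (fun z : E × E => Γ (s, z.1, z.2)) (z.1 - (t - s) • z.2, z.2)‖) := by
            rw [pow_add]; ring
        _ ≤ (1 + T) ^ (k + (N + 1)) * gTop s := mul_le_mul_of_nonneg_left hgi (by positivity)
    -- Leibniz, peeling off `i = 0` and `i = N + 1`
    have hsec_eq : (fun r : E × E => Kf (id s, r)) = fun r => Ef s r * Γ (s, r.1 - (t - s) • r.2, r.2) := by
      funext r; rfl
    rw [hsec_eq]
    have hleib := norm_iteratedFDeriv_mul_le (n := N + 1) (hEfs s) hΓS z (by exact_mod_cast le_top)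
    refine (mul_le_mul_of_nonneg_left hleib hw0.le).trans ?_
    rw [Finset.mul_sum, Finset.sum_range_succ', Finset.sum_range_succ]
    -- `i = 0`: top order of `Ef s`, order zero of the source
    have hterm0 : w * (((N + 1).choose 0 : ℝ) * ‖iteratedFDeriv ℝ 0 (Ef s) z‖ *
        ‖iteratedFDeriv ℝ (N + 1 - 0) (fun r : E × E => Γ (s, r.1 - (t - s) • r.2, r.2)) z‖) ≤
        (1 + T) ^ (k + (N + 1)) * gTop s := by
      simp only [Nat.choose_zero_right, Nat.cast_one, one_mul, Nat.sub_zero]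
      have hE0 := hEcr s hs0 hst 0 (Nat.zero_le _) z
      simp only [hcr, Nat.factorial_zero, Nat.cast_one, pow_zero, mul_one] at hE0
      calc w * (‖iteratedFDeriv ℝ 0 (Ef s) z‖ * ‖iteratedFDeriv ℝ (N + 1) (fun r : E × E => Γ (s, r.1 - (t - s) • r.2, r.2)) z‖)
          = ‖iteratedFDeriv ℝ 0 (Ef s) z‖ * (w * ‖iteratedFDeriv ℝ (N + 1) (fun r : E × E => Γ (s, r.1 - (t - s) • r.2, r.2)) z‖) := by
            ring
        _ ≤ 1 * ((1 + T) ^ (k + (N + 1)) * gTop s) :=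
            mul_le_mul hE0 hΓtop (by positivity) zero_le_one
        _ = _ := one_mul _
    -- `i = N + 1` (last index `N` of the shifted sum): top order of `Ef s`, order zero of the source
    have htermN : w * (((N + 1).choose (N + 1) : ℝ) * ‖iteratedFDeriv ℝ (N + 1) (Ef s) z‖ *
        ‖iteratedFDeriv ℝ (N + 1 - (N + 1)) (fun r : E × E => Γ (s, r.1 - (t - s) • r.2, r.2)) z‖) ≤
        (1 + T) ^ k * gC 0 * ε' + (1 + T) ^ (k + (N + 1)) * (gC 0 * L) := by
      rw [show N + 1 - (N + 1) = 0 from Nat.sub_self _]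
      simp only [Nat.choose_self, Nat.cast_one, one_mul]
      have hG0 := hΓi 0 (Nat.zero_le _)
      rw [add_zero] at hG0
      calc w * (‖iteratedFDeriv ℝ (N + 1) (Ef s) z‖ * ‖iteratedFDeriv ℝ 0 (fun r : E × E => Γ (s, r.1 - (t - s) • r.2, r.2)) z‖)
          = ‖iteratedFDeriv ℝ (N + 1) (Ef s) z‖ * (w * ‖iteratedFDeriv ℝ 0 (fun r : E × E => Γ (s, r.1 - (t - s) • r.2, r.2)) z‖) := by
            ring
        _ ≤ ((1 + T) ^ (N + 1) * L + ε') * ((1 + T) ^ k * gC 0) :=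
            mul_le_mul (hEtop s hs0 hst z) hG0 (by positivity) (by positivity)
        _ = (1 + T) ^ k * gC 0 * ε' + (1 + T) ^ (k + (N + 1)) * (gC 0 * L) := by rw [pow_add]; ring
    -- middle terms `i + 1`, `i < N`: crude bounds on both factors
    have hterms : ∀ i ∈ Finset.range N,
        w * (((N + 1).choose (i + 1) : ℝ) * ‖iteratedFDeriv ℝ (i + 1) (Ef s) z‖ *
          ‖iteratedFDeriv ℝ (N + 1 - (i + 1)) (fun r : E × E => Γ (s, r.1 - (t - s) • r.2, r.2)) z‖) ≤
          ((N + 1).choose (i + 1) : ℝ) * cr (i + 1) * ((1 + T) ^ (k + (N - i)) * gC (N - i)) := by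
      intro i hi
      rw [Finset.mem_range] at hi
      rw [show N + 1 - (i + 1) = N - i by omega]
      have h1 := hEcr s hs0 hst (i + 1) (by omega) z
      have h2 := hΓi (N - i) (Nat.sub_le _ _)
      calc w * (((N + 1).choose (i + 1) : ℝ) * ‖iteratedFDeriv ℝ (i + 1) (Ef s) z‖ *
            ‖iteratedFDeriv ℝ (N - i) (fun r : E × E => Γ (s, r.1 - (t - s) • r.2, r.2)) z‖)
          = ((N + 1).choose (i + 1) : ℝ) * ‖iteratedFDeriv ℝ (i + 1) (Ef s) z‖ *
              (w * ‖iteratedFDeriv ℝ (N - i) (fun r : E × E => Γ (s, r.1 - (t - s) • r.2, r.2)) z‖) := by ring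
        _ ≤ ((N + 1).choose (i + 1) : ℝ) * cr (i + 1) * ((1 + T) ^ (k + (N - i)) * gC (N - i)) :=
            mul_le_mul (mul_le_mul_of_nonneg_left h1 (by positivity)) h2 (by positivity)
              (by have := hcr0 (i + 1); positivity)
    have hsum := Finset.sum_le_sum hterms
    rw [hA₂]
    linarith [hsum, hterm0, htermN]
  -- integrate the section bounds over `s ∈ (0, t]`
  have hbound2 : w * ‖iteratedFDeriv ℝ (N + 1) T2f z‖ ≤
      T * A₂ + (1 + T) ^ (k + (N + 1)) * (T * gC 0 * L + Gi) := by
    rw [hT2eq]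
    have hnorm := norm_iteratedFDeriv_parametric_integral_le (μ := μ) measurable_id isCompact_Icc hKmem hKs (N + 1) z
    refine (mul_le_mul_of_nonneg_left hnorm hw0.le).trans ?_
    rw [← MeasureTheory.integral_const_mul]
    have hint : Integrable (fun s => ‖iteratedFDeriv ℝ (N + 1) (fun r : E × E => Kf (id s, r)) z‖) μ :=
      (integrable_iteratedFDeriv_section (μ := μ) measurable_id isCompact_Icc hKmem hKs (N + 1) z).norm
    have hbc : Continuous fun s : ℝ => A₂ + (1 + T) ^ (k + (N + 1)) * (gC 0 * L + gTop s) :=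
      continuous_const.add (continuous_const.mul (continuous_const.add hgTopc))
    calc ∫ s, w * ‖iteratedFDeriv ℝ (N + 1) (fun r : E × E => Kf (id s, r)) z‖ ∂μ
        ≤ ∫ s, A₂ + (1 + T) ^ (k + (N + 1)) * (gC 0 * L + gTop s) ∂μ := by
          rw [hμ]
          exact setIntegral_mono_on (hint.const_mul w |>.mono_measure (le_refl _) |> fun h => by rw [hμ] at h; exact h)
            (hbc.integrableOn_Icc.mono_set Ioc_subset_Icc_self) measurableSet_Ioc hKsec
      _ = ∫ s in (0 : ℝ)..t, (A₂ + (1 + T) ^ (k + (N + 1)) * (gC 0 * L + gTop s)) := by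
          rw [hμ, ← intervalIntegral.integral_of_le ht0]
      _ = t * A₂ + (1 + T) ^ (k + (N + 1)) * (t * (gC 0 * L) + Gi) := by
          have hI1 : IntervalIntegrable (fun s : ℝ => (1 + T) ^ (k + (N + 1)) * (gC 0 * L + gTop s)) volume 0 t :=
            (continuous_const.mul (continuous_const.add hgTopc)).intervalIntegrable _ _
          have hI2 : IntervalIntegrable (fun s : ℝ => gTop s) volume 0 t := hgTopc.intervalIntegrable _ _
          rw [intervalIntegral.integral_add (f := fun _ => A₂) (g := fun s => (1 + T) ^ (k + (N + 1)) * (gC 0 * L + gTop s))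
              intervalIntegrable_const hI1,
            intervalIntegral.integral_const,
            intervalIntegral.integral_const_mul ((1 + T) ^ (k + (N + 1))) (fun s => gC 0 * L + gTop s),
            intervalIntegral.integral_add (f := fun _ => gC 0 * L) (g := fun s => gTop s) intervalIntegrable_const hI2,
            intervalIntegral.integral_const, hGi]
          simp only [sub_zero, smul_eq_mul]
      _ ≤ T * A₂ + (1 + T) ^ (k + (N + 1)) * (T * gC 0 * L + Gi) := by
          have h1 : t * A₂ ≤ T * A₂ := mul_le_mul_of_nonneg_right htT hA₂0
          have h2 : t * (gC 0 * L) ≤ T * gC 0 * L := by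
            rw [mul_assoc]; exact mul_le_mul_of_nonneg_right htT (by have := hgC0 0; positivity)
          have h3 : (1 + T) ^ (k + (N + 1)) * (t * (gC 0 * L) + Gi) ≤ (1 + T) ^ (k + (N + 1)) * (T * gC 0 * L + Gi) :=
            mul_le_mul_of_nonneg_left (by linarith) (by positivity)
          linarith
  -- (3) assemble: the slice of `U` is `T1f + T2f`
  have hUeq : (fun z : E × E => U (t, z.1, z.2)) = T1f + T2f := by
    funext z
    rw [Pi.add_apply, hU]
    simp only [hT1f, hT2f, hKf, hEf, neg_one_mul]
  rw [hUeq, iteratedFDeriv_add_apply (hT1s.of_le (by exact_mod_cast le_top)).contDiffAt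
    (hT2s.of_le (by exact_mod_cast le_top)).contDiffAt]
  calc w * ‖iteratedFDeriv ℝ (N + 1) T1f z + iteratedFDeriv ℝ (N + 1) T2f z‖
      ≤ w * (‖iteratedFDeriv ℝ (N + 1) T1f z‖ + ‖iteratedFDeriv ℝ (N + 1) T2f z‖) :=
        mul_le_mul_of_nonneg_left (norm_add_le _ _) hw0.le
    _ = w * ‖iteratedFDeriv ℝ (N + 1) T1f z‖ + w * ‖iteratedFDeriv ℝ (N + 1) T2f z‖ := mul_add _ _ _
    _ ≤ (A₁ + (1 + T) ^ (k + (N + 1)) * F 0 * L) + (T * A₂ + (1 + T) ^ (k + (N + 1)) * (T * gC 0 * L + Gi)) :=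
        add_le_add hbound1 hbound2
    _ = A₁ + T * A₂ + (1 + T) ^ (k + (N + 1)) * (F 0 + T * gC 0) * L + (1 + T) ^ (k + (N + 1)) * Gi := by ring

end DuhamelSlice

end Literature.MathematicalPhysics.KineticTheory

end
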